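import Literature.Geometry.Lorentzian.KerrDeSitterSurfaceGravities
import HarnessLib

/-!
# Subextremality of Kerr–de Sitter FROM the roots of `Δ_r`: the sign-pattern characterisation of the
# horizon radii and `IsSubextremal ⇔ Δ_r factorises with three ordered non-negative roots` (theorems only)

Theorems only (no named facts, no new definitions). The tree's `IsSubextremal M a Λ`
(`KerrDeSitter.lean`) is stated through the radii `rMinus` / `rPlus` / `rCosmo`, which are DEFINED as
`sInf {r | 0 < r ∧ Δ_r ≤ 0}`, `sSup {r | r < r_c ∧ Δ_r ≤ 0}`, `sSup {r | 0 < Δ_r}`. The printed sources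
state subextremality through the ROOTS: Casals–Teixeira da Costa [CasalsTeixeiradacosta2022, (3.1)–(3.2)]
"`Δ` has four distinct real roots `r₃ < 0 < r₀ < r₁ < r₂`", `Δ = −L⁻²(r−r₀)(r−r₁)(r−r₂)(r−r₃)`;
Petersen–Vasy [PetersenVasy2021, (1.2)–(1.3)] (three positive roots of `μ`, sign pattern). This file
proves the two readings coincide:

* `horizons_of_signs` — if `0 < M`, `0 < Λ`, `0 ≤ r₀ < r₁ < r₂` (`r₁, r₂` zeros of `Δ_r`) with the sign pattern
  `Δ_r > 0` on `(0, r₀)`, `< 0` on `(r₀, r₁)`, `> 0` on `(r₁, r₂)`, `< 0` beyond `r₂`, then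
  `IsSubextremal M a Λ` and `rMinus = r₀`, `rPlus = r₁`, `rCosmo = r₂` (the `sInf`/`sSup` are identified;
  the pattern used per tile in `Summits/Ventures/KdS/HorizonCert.lean` for `M = 1`, here for every `M`);
* `horizons_of_factorisation` — the same conclusion from the printed factorised form
  `Δ_r = −(Λ/3)(r−x)(r−y)(r−z)(r+x+y+z)` with `0 ≤ x < y < z` (the sign pattern is read off the product);
* `isSubextremal_iff_factorisation` — **`IsSubextremal M a Λ ↔ 0 < M ∧ 0 < Λ ∧ ∃ x y z, 0 ≤ x < y < z ∧
  ∀ r, Δ_r = −(Λ/3)(r−x)(r−y)(r−z)(r+x+y+z)`** (`→` is `delta_eq_prod`, `KerrDeSitterSurfaceGravities`).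

## References
* M. Casals, R. Teixeira da Costa, Commun. Math. Phys. 394 (2022), arXiv:2105.13329 v3, (3.1)–(3.2).
  [CasalsTeixeiradacosta2022]
* O. L. Petersen, A. Vasy, arXiv:2112.01355, (1.1)–(1.3). [PetersenVasy2021]
-/

noncomputable section

open Set

namespace Literature.Geometry.Lorentzian.KerrDeSitter

section FromRoots

variable {M a Λ : ℝ}

/-- **The horizon radii from the sign pattern.** If `M, Λ > 0`, `0 ≤ r₀ < r₁ < r₂`, `r₁, r₂` are zeros
of `Δ_r`, and `Δ_r > 0` on `(0, r₀)`, `Δ_r < 0` on `(r₀, r₁)`, `Δ_r > 0` on `(r₁, r₂)`, `Δ_r < 0` on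
`(r₂, ∞)`, then the parameters are subextremal and `r₋ = r₀`, `r₊ = r₁`, `r_c = r₂` (the defining
`sInf`/`sSup` are identified; `Δ_r(r₀) = 0` follows by continuity and is not needed).
[cite: PetersenVasy2021, (1.2)–(1.3)] -/
theorem horizons_of_signs {r₀ r₁ r₂ : ℝ} (hM : 0 < M) (hΛ : 0 < Λ) (h0 : 0 ≤ r₀) (h01 : r₀ < r₁)
    (h12 : r₁ < r₂) (hz₁ : delta M a Λ r₁ = 0) (hz₂ : delta M a Λ r₂ = 0)
    (hA : ∀ r, 0 < r → r < r₀ → 0 < delta M a Λ r) (hB : ∀ r, r₀ < r → r < r₁ → delta M a Λ r < 0)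
    (hC : ∀ r, r₁ < r → r < r₂ → 0 < delta M a Λ r) (hD : ∀ r, r₂ < r → delta M a Λ r < 0) :
    IsSubextremal M a Λ ∧ rMinus M a Λ = r₀ ∧ rPlus M a Λ = r₁ ∧ rCosmo M a Λ = r₂ := by
  -- rCosmo = r₂
  have hc : rCosmo M a Λ = r₂ := by
    unfold rCosmo
    refine IsLUB.csSup_eq ⟨?_, ?_⟩ ⟨(r₁ + r₂) / 2, ?_⟩
    · intro r (hr : 0 < delta M a Λ r)
      by_contra h
      exact absurd hr (not_lt.mpr (hD r (not_le.mp h)).le)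
    · intro b hb
      by_contra h
      rw [not_le] at h
      set r := (max b r₁ + r₂) / 2 with hr_def
      have hm := max_lt h h12
      have hr1 : max b r₁ < r := by rw [hr_def]; linarith
      have hr2 : r < r₂ := by rw [hr_def]; linarith
      have hpos : 0 < delta M a Λ r := hC r (lt_of_le_of_lt (le_max_right b r₁) hr1) hr2
      have := hb hpos
      linarith [le_max_left b r₁]
    · show 0 < delta M a Λ ((r₁ + r₂) / 2)
      exact hC _ (by linarith) (by linarith)
  -- rPlus = r₁
  have hp : rPlus M a Λ = r₁ := by
    unfold rPlus
    rw [hc]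
    refine IsGreatest.csSup_eq ⟨⟨h12, hz₁.le⟩, ?_⟩
    intro r ⟨hrlt, hrle⟩
    by_contra h
    exact absurd hrle (not_le.mpr (hC r (not_le.mp h) hrlt))
  -- rMinus = r₀ (as an infimum; attained iff `r₀ > 0`, i.e. `a ≠ 0`)
  have hm : rMinus M a Λ = r₀ := by
    unfold rMinus
    refine IsGLB.csInf_eq ⟨?_, ?_⟩ ⟨(r₀ + r₁) / 2, ?_⟩
    · intro r ⟨hr0, hrle⟩
      by_contra h
      exact absurd hrle (not_le.mpr (hA r hr0 (not_le.mp h)))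
    · intro b hb
      by_contra h
      rw [not_le] at h
      set r := (r₀ + min b r₁) / 2 with hr_def
      have hmin : r₀ < min b r₁ := lt_min h h01
      have hr0 : r₀ < r := by rw [hr_def]; linarith
      have hr1 : r < min b r₁ := by rw [hr_def]; linarith
      have hmem : r ∈ {r | 0 < r ∧ delta M a Λ r ≤ 0} :=
        ⟨lt_of_le_of_lt h0 hr0, (hB r hr0 (lt_of_lt_of_le hr1 (min_le_right b r₁))).le⟩
      have := hb hmem
      linarith [min_le_left b r₁]
    · exact ⟨by linarith, (hB _ (by linarith) (by linarith)).le⟩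
  refine ⟨⟨hM, hΛ, ?_, ?_, ?_, ?_, ?_, ?_, ?_⟩, hm, hp, hc⟩
  · rw [hm, hp]; exact h01
  · rw [hp, hc]; exact h12
  · rw [hp]; exact hz₁
  · rw [hc]; exact hz₂
  · intro r hr; rw [hm, hp] at hr; exact hB r hr.1 hr.2
  · intro r hr; rw [hp, hc] at hr; exact hC r hr.1 hr.2
  · intro r hr; rw [hc] at hr; exact hD r hr

/-- **The horizon radii from the printed factorised form** `Δ_r = −(Λ/3)(r−x)(r−y)(r−z)(r+x+y+z)` with
`0 ≤ x < y < z` and `M, Λ > 0`: the sign pattern of the product gives `IsSubextremal` with `r₋ = x`,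
`r₊ = y`, `r_c = z`. [cite: CasalsTeixeiradacosta2022, (3.1)–(3.2)] -/
theorem horizons_of_factorisation {x y z : ℝ} (hM : 0 < M) (hΛ : 0 < Λ) (hx : 0 ≤ x) (hxy : x < y)
    (hyz : y < z)
    (hΔ : ∀ r, delta M a Λ r = -(Λ / 3) * (r - x) * (r - y) * (r - z) * (r + x + y + z)) :
    IsSubextremal M a Λ ∧ rMinus M a Λ = x ∧ rPlus M a Λ = y ∧ rCosmo M a Λ = z := by
  have hℓ : 0 < Λ / 3 := by positivity
  refine horizons_of_signs hM hΛ hx hxy hyz (by rw [hΔ]; ring) (by rw [hΔ]; ring) ?_ ?_ ?_ ?_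
  · intro r hr0 hrx
    rw [hΔ]
    have h1 : 0 < x - r := by linarith
    have h2 : 0 < y - r := by linarith
    have h3 : 0 < z - r := by linarith
    have h4 : 0 < r + x + y + z := by linarith
    have : -(Λ / 3) * (r - x) * (r - y) * (r - z) * (r + x + y + z) =
        Λ / 3 * ((x - r) * (y - r) * (z - r)) * (r + x + y + z) := by ring
    rw [this]; positivity
  · intro r hrx hry
    rw [hΔ]
    have h1 : 0 < r - x := by linarith
    have h2 : 0 < y - r := by linarith
    have h3 : 0 < z - r := by linarith
    have h4 : 0 < r + x + y + z := by linarith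
    have : -(Λ / 3) * (r - x) * (r - y) * (r - z) * (r + x + y + z) =
        -(Λ / 3 * ((r - x) * (y - r) * (z - r)) * (r + x + y + z)) := by ring
    rw [this, neg_lt_zero]; positivity
  · intro r hry hrz
    rw [hΔ]
    have h1 : 0 < r - x := by linarith
    have h2 : 0 < r - y := by linarith
    have h3 : 0 < z - r := by linarith
    have h4 : 0 < r + x + y + z := by linarith
    have : -(Λ / 3) * (r - x) * (r - y) * (r - z) * (r + x + y + z) =
        Λ / 3 * ((r - x) * (r - y) * (z - r)) * (r + x + y + z) := by ring
    rw [this]; positivity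
  · intro r hrz
    rw [hΔ]
    have h1 : 0 < r - x := by linarith
    have h2 : 0 < r - y := by linarith
    have h3 : 0 < r - z := by linarith
    have h4 : 0 < r + x + y + z := by linarith
    have : -(Λ / 3) * (r - x) * (r - y) * (r - z) * (r + x + y + z) =
        -(Λ / 3 * ((r - x) * (r - y) * (r - z)) * (r + x + y + z)) := by ring
    rw [this, neg_lt_zero]; positivity

/-- **`IsSubextremal ⇔ Δ_r factorises with three ordered non-negative roots`** (the fourth root being
minus their sum): the tree's `sInf`/`sSup` definition of subextremality coincides with the printed
"`Δ` has the distinct real roots `r₃ < 0 ≤ r₀ < r₁ < r₂`, `Δ = −L⁻²∏(r − r_j)`" reading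
(`r₀ = 0` exactly when `a = 0`). `→`: `delta_eq_prod`; `←`: `horizons_of_factorisation`.
[cite: CasalsTeixeiradacosta2022, (3.1)–(3.2)] -/
theorem isSubextremal_iff_factorisation :
    IsSubextremal M a Λ ↔ 0 < M ∧ 0 < Λ ∧ ∃ x y z : ℝ, 0 ≤ x ∧ x < y ∧ y < z ∧
      ∀ r, delta M a Λ r = -(Λ / 3) * (r - x) * (r - y) * (r - z) * (r + x + y + z) := by
  constructor
  · intro h
    exact ⟨h.1, h.2.1, rMinus M a Λ, rPlus M a Λ, rCosmo M a Λ, rMinus_nonneg M a Λ, h.2.2.1,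
      h.2.2.2.1, delta_eq_prod h⟩
  · rintro ⟨hM, hΛ, x, y, z, hx, hxy, hyz, hΔ⟩
    exact (horizons_of_factorisation hM hΛ hx hxy hyz hΔ).1

/-- In the factorised form the roots ARE the horizon radii (uniqueness of the presentation).
[cite: CasalsTeixeiradacosta2022, (3.2)] -/
theorem radii_of_factorisation {x y z : ℝ} (hM : 0 < M) (hΛ : 0 < Λ) (hx : 0 ≤ x) (hxy : x < y)
    (hyz : y < z)
    (hΔ : ∀ r, delta M a Λ r = -(Λ / 3) * (r - x) * (r - y) * (r - z) * (r + x + y + z)) :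
    rMinus M a Λ = x ∧ rPlus M a Λ = y ∧ rCosmo M a Λ = z :=
  (horizons_of_factorisation hM hΛ hx hxy hyz hΔ).2

end FromRoots

end Literature.Geometry.Lorentzian.KerrDeSitter

end
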